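import Literature.MathematicalPhysics.QuantumFieldTheory.OSMeanValueBound
import HarnessLib

/-!
# The mean-value bound with an abstract continuation of the smeared Schwinger function (OS II, Ch. VI.1)

Topic `Literature/MathematicalPhysics/QuantumFieldTheory`; support file (all proved; no new
definitions; no named facts). The generic form of `OSMeanValueIdentity` / `OSMeanValueBound`:
the sector extension `geomG` of the Gaussian-window engine is replaced by an **abstract family**
`Γ v` of functions of the complex configuration, holomorphic on `ball (cfgPt x) ρ₂`, whose real
values are the Schwinger functions of the clusters of frame profiles,
`Γ v (cfgPt X) = 𝔖_{k+2}(⊗ⱼ κ_{v,j}(· − Xⱼ))`, and which is bounded by `GB` on the ball. No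
growth condition (E0'), positivity (E2) or covariance (E1) is used here — they enter only the
construction of such a `Γ` (Osterwalder–Schrader II (6.8)–(6.15): the scalar-product
representation, the one-variable continuations and the maximum principle with the weight
`(1 + Σ w)^{-P}`). Results:

* `integral_density_mul_tensorFin_eq_schwinger` — the local representation on a cluster;
* `mvTheta_cfgPt_eq_schwinger` — real values of the smeared density `Θ_v`;
* `mvTheta_eqOn_of_realValues` — `Θ_v = Γ_v` on the ball (real environment + identity theorem);
* `norm_density_le_meanValue_generic` —
  `‖S(cfgPt x)‖ ≤ π^{-N} (2√(2r₁))^N · GB`, `N = (k+2)d`.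

## References

* K. Osterwalder, R. Schrader, *Axioms for Euclidean Green's functions II*, Comm. Math. Phys. 42
  (1975) 281–305, Ch. VI.1 (6.4)–(6.15). [OsterwalderSchraderCMP1975]
-/

noncomputable section

open MeasureTheory Complex Set Metric Filter
open _root_.Topology
open scoped InnerProductSpace RealInnerProductSpace SchwartzMap NNReal Real

namespace Literature.MathematicalPhysics.QuantumFieldTheory

open Literature.MathematicalPhysics.QuantumLattice (SchwingerFamily IsPositiveTimeMulti schwartzNorm)
open Literature.MathematicalPhysics.QuantumLattice.SchwingerFamily
open Literature.Analysis.FunctionSpaces.SchwartzAverage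
open Literature.Analysis.Distribution
open Literature.Analysis.Complex
open OSFrames

variable {d : ℕ} [NeZero d]

section Generic

variable (𝔖 : SchwingerFamily (EuclideanSpace ℝ (Fin d))) {k : ℕ}
  (ê : Fin d → EuclideanSpace ℝ (Fin d)) (hli : LinearIndependent ℝ ê) {r₀ : ℝ}
  {M : ℕ} {r₁ : ℝ} (hr₁ : 0 < r₁)
  -- the local holomorphic density
  {x : Fin (k + 2) → EuclideanSpace ℝ (Fin d)} {ρ ρ₂ : ℝ} {S : (Fin (k + 2) → Fin d → ℂ) → ℂ}
  (hSd : DifferentiableOn ℂ S (ball (cfgPt x) ρ)) {Bs : ℝ} (hSB : ∀ ζ ∈ ball (cfgPt x) ρ, ‖S ζ‖ ≤ Bs)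
  (hSrep : ∀ F : 𝓢((Fin (k + 2) → EuclideanSpace ℝ (Fin d)), ℂ),
    tsupport (F : (Fin (k + 2) → EuclideanSpace ℝ (Fin d)) → ℂ) ⊆ Metric.ball x ρ → 𝔖 (k + 2) F = ∫ y, S (cfgPt y) * F y)
  (hρ₂ : 0 < ρ₂)
  (hr₀eq : ‖(frameMap ê hli : EuclideanSpace ℝ (Fin d) →L[ℝ] EuclideanSpace ℝ (Fin d))‖ * Real.sqrt (2 * d * r₁) ≤ r₀)
  (hρρ : ρ₂ + r₀ < ρ)
  -- the abstract continuation of the smeared Schwinger function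
  (Γ : (Fin (k + 2) → Fin d → ℝ) → (Fin (k + 2) → Fin d → ℂ) → ℂ)
  (hΓd : ∀ vb, DifferentiableOn ℂ (Γ vb) (ball (cfgPt x) ρ₂))
  (hΓreal : ∀ vb (X : Fin (k + 2) → EuclideanSpace ℝ (Fin d)), ‖X - x‖ < ρ₂ →
    Γ vb (cfgPt X) = 𝔖 (k + 2) (skeletonFnV (SchwartzMap.tensorFin (k + 2) (frameProfs ê hli M hr₁ vb)) X))

omit [NeZero d] in
include hSrep hr₀eq hρρ in
/-- **The local representation on a cluster** centred at `X` with `‖X − x‖ + r₀ < ρ`: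
`∫ S(cfgPt y) ∏ⱼ φⱼ(yⱼ − Xⱼ) dy = 𝔖_{k+2}(⊗φ(· − X))` for the frame profiles. [folklore] -/
theorem integral_density_mul_tensorFin_eq_schwinger (vb : Fin (k + 2) → Fin d → ℝ)
    {X : Fin (k + 2) → EuclideanSpace ℝ (Fin d)} (hX : ‖X - x‖ < ρ₂) :
    ∫ y, S (cfgPt y) * SchwartzMap.tensorFin (k + 2) (frameProfs ê hli M hr₁ vb) (fun j => y j - X j) =
      𝔖 (k + 2) (skeletonFnV (SchwartzMap.tensorFin (k + 2) (frameProfs ê hli M hr₁ vb)) X) := by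
  have hr₀0 : 0 ≤ r₀ := le_trans (by positivity) hr₀eq
  have hsupp : tsupport (skeletonFnV (SchwartzMap.tensorFin (k + 2) (frameProfs ê hli M hr₁ vb)) X :
      (Fin (k + 2) → EuclideanSpace ℝ (Fin d)) → ℂ) ⊆ Metric.ball x ρ := by
    refine (tsupport_skeletonFnV_tensorFin_subset _ hr₀0 (tsupport_frameProfs_subset ê hli M hr₁ hr₀eq vb) X).trans fun y hy => ?_
    rw [mem_closedBall, dist_eq_norm] at hy
    rw [mem_ball, dist_eq_norm]
    calc ‖y - x‖ = ‖(y - X) + (X - x)‖ := by rw [sub_add_sub_cancel]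
      _ ≤ ‖y - X‖ + ‖X - x‖ := norm_add_le _ _
      _ < ρ := by linarith
  have hrep := hSrep _ hsupp
  simp only [skeletonFnV_apply] at hrep
  exact hrep.symm

omit [NeZero d] in
include hSrep hρ₂ hr₀eq hρρ in
/-- **Real values of `Θ_v`**: `Θ_v(cfgPt X) = 𝔖_{k+2}(⊗κ_v(· − X))` for `‖X − x‖ < ρ₂`. [cite: OsterwalderSchraderCMP1975, Ch. VI.1 (6.6), (6.8)] -/
theorem mvTheta_cfgPt_eq_schwinger (vb : Fin (k + 2) → Fin d → ℝ) {X : Fin (k + 2) → EuclideanSpace ℝ (Fin d)} (hX : ‖X - x‖ < ρ₂) :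
    mvTheta ê hli M hr₁ S vb (cfgPt X) = 𝔖 (k + 2) (skeletonFnV (SchwartzMap.tensorFin (k + 2) (frameProfs ê hli M hr₁ vb)) X) := by
  have h1 : mvTheta ê hli M hr₁ S vb (cfgPt X) =
      ∫ c : Fin (k + 2) → EuclideanSpace ℝ (Fin d), (fun y => S (cfgPt y)) (fun j => X j + frameMap ê hli (c j)) *
        ∏ j, prodProfile M hr₁ (vb j) (c j) := by
    simp only [mvTheta, prodKer, cfgPt_add_frameShift]
  rw [h1, integral_mul_prod_prodProfile_eq ê hli M hr₁ (k + 2) (fun y => S (cfgPt y)) X vb]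
  have h2 : (fun y : Fin (k + 2) → EuclideanSpace ℝ (Fin d) => S (cfgPt y) * ∏ j, frameProfile ê hli M hr₁ (vb j) (y j - X j)) =
      fun y => S (cfgPt y) * SchwartzMap.tensorFin (k + 2) (frameProfs ê hli M hr₁ vb) (fun j => y j - X j) := by
    funext y; rw [SchwartzMap.tensorFin_apply]; rfl
  rw [h2]
  have := hρ₂
  exact integral_density_mul_tensorFin_eq_schwinger 𝔖 ê hli hr₁ hSrep hr₀eq hρρ vb hX

omit [NeZero d] in
include hSd hSB hSrep hρ₂ hr₀eq hρρ hΓd hΓreal in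
/-- **`Θ_v = Γ_v` on the ball** (real environment + identity theorem). [cite: OsterwalderSchraderCMP1975, Ch. VI.1 (6.6)–(6.9)] -/
theorem mvTheta_eqOn_of_realValues (vb : Fin (k + 2) → Fin d → ℝ) :
    EqOn (mvTheta ê hli M hr₁ S vb) (Γ vb) (ball (cfgPt x) ρ₂) := by
  have hf := differentiableOn_mvTheta (M := M) ê hli hr₁ hSd hSB hr₀eq hρρ vb
  have hg' := hΓd vb
  have hfa := SCV.analyticOnNhd_of_differentiableOn hf isOpen_ball
  have hga := SCV.analyticOnNhd_of_differentiableOn hg' isOpen_ball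
  have hd0 : (0 : ℝ) < Real.sqrt d + 1 := by positivity
  set ρ₃ : ℝ := ρ₂ / (Real.sqrt d + 1) with hρ₃
  have hρ₃0 : 0 < ρ₃ := by positivity
  have hρ₃le : ρ₃ ≤ ρ₂ := by
    rw [hρ₃, div_le_iff₀ hd0]
    nlinarith [Real.sqrt_nonneg (d : ℝ)]
  have hev := SCV.eventually_eq_of_eq_on_reals_pi₂ (x₀ := fun j μ => x j μ) (f := mvTheta ê hli M hr₁ S vb)
    (g := Γ vb) hρ₃0 (hf.mono (ball_subset_ball hρ₃le)) (hg'.mono (ball_subset_ball hρ₃le))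
    (fun w hw => by
      set X : Fin (k + 2) → EuclideanSpace ℝ (Fin d) := fun j => WithLp.toLp 2 (w j) with hXdef
      have hXc : (fun a b => ((w a b : ℝ) : ℂ)) = cfgPt X := rfl
      have hxc : (fun a b => ((x a b : ℝ) : ℂ)) = cfgPt x := rfl
      rw [hXc, hxc] at hw
      rw [hXc]
      have hX : ‖X - x‖ < ρ₂ := by
        have h1 := norm_le_sqrt_mul_norm_cfgPt (X - x)
        rw [cfgPt_sub] at h1
        calc ‖X - x‖ ≤ Real.sqrt d * ‖cfgPt X - cfgPt x‖ := h1
          _ ≤ Real.sqrt d * ρ₃ := mul_le_mul_of_nonneg_left hw.le (Real.sqrt_nonneg _)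
          _ < (Real.sqrt d + 1) * ρ₃ := by nlinarith
          _ = ρ₂ := by rw [hρ₃, mul_div_cancel₀ _ hd0.ne']
      rw [mvTheta_cfgPt_eq_schwinger 𝔖 ê hli hr₁ hSrep hρ₂ hr₀eq hρρ vb hX, hΓreal vb X hX])
  exact hfa.eqOn_of_preconnected_of_eventuallyEq hga (convex_ball _ _).isPreconnected (mem_ball_self hρ₂) hev

end Generic

/-! ### The bound -/

section Bound

variable (𝔖 : SchwingerFamily (EuclideanSpace ℝ (Fin d))) {k : ℕ}
  (ê : Fin d → EuclideanSpace ℝ (Fin d)) (hli : LinearIndependent ℝ ê) (hê1 : ∀ μ, ‖ê μ‖ = 1) {r₀ : ℝ}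
  {M : ℕ} {r₁ : ℝ} (hr₁ : 0 < r₁)
  {x : Fin (k + 2) → EuclideanSpace ℝ (Fin d)} {ρ ρ₂ : ℝ} {S : (Fin (k + 2) → Fin d → ℂ) → ℂ}
  (hSd : DifferentiableOn ℂ S (ball (cfgPt x) ρ)) {Bs : ℝ} (hSB : ∀ ζ ∈ ball (cfgPt x) ρ, ‖S ζ‖ ≤ Bs)
  (hSrep : ∀ F : 𝓢((Fin (k + 2) → EuclideanSpace ℝ (Fin d)), ℂ),
    tsupport (F : (Fin (k + 2) → EuclideanSpace ℝ (Fin d)) → ℂ) ⊆ Metric.ball x ρ → 𝔖 (k + 2) F = ∫ y, S (cfgPt y) * F y)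
  (hρ₂ : 0 < ρ₂)
  (hr₀eq : ‖(frameMap ê hli : EuclideanSpace ℝ (Fin d) →L[ℝ] EuclideanSpace ℝ (Fin d))‖ * Real.sqrt (2 * d * r₁) ≤ r₀)
  (hρρ : ρ₂ + r₀ < ρ)
  (Γ : (Fin (k + 2) → Fin d → ℝ) → (Fin (k + 2) → Fin d → ℂ) → ℂ)
  (hΓd : ∀ vb, DifferentiableOn ℂ (Γ vb) (ball (cfgPt x) ρ₂))
  (hΓreal : ∀ vb (X : Fin (k + 2) → EuclideanSpace ℝ (Fin d)), ‖X - x‖ < ρ₂ →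
    Γ vb (cfgPt X) = 𝔖 (k + 2) (skeletonFnV (SchwartzMap.tensorFin (k + 2) (frameProfs ê hli M hr₁ vb)) X))
  {GB : ℝ} (hΓB : ∀ vb, ∀ ζ ∈ ball (cfgPt x) ρ₂, ‖Γ vb ζ‖ ≤ GB)
  -- the polydisc fits
  (hfit : ((k + 2) * d : ℝ) * (2 * Real.sqrt (2 * r₁)) < ρ₂)
  (hfit2 : ‖(frameMap ê hli : EuclideanSpace ℝ (Fin d) →L[ℝ] EuclideanSpace ℝ (Fin d))‖ * Real.sqrt d * Real.sqrt (2 * r₁) < ρ₂)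

include hê1 hSd hSB hSrep hρ₂ hr₀eq hρρ hΓd hΓreal hΓB hfit hfit2

omit [NeZero d] in
/-- **The mean-value bound, generic form** (OS II Ch. VI.1 (6.4)–(6.7)):
`‖S(cfgPt x)‖ ≤ π^{-N} (2√(2r₁))^N · GB`. [cite: OsterwalderSchraderCMP1975, Ch. VI.1 (6.4)–(6.7)] -/
theorem norm_density_le_meanValue_generic :
    ‖S (cfgPt x)‖ ≤ (π ^ ((k + 2) * d))⁻¹ * (2 * Real.sqrt (2 * r₁)) ^ ((k + 2) * d) * GB := by
  -- abbreviations
  set N : ℕ := (k + 2) * d with hN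
  set R₁ : ℝ := Real.sqrt (2 * r₁) with hR₁
  set R : ℝ := 2 * R₁ with hR
  have hR0 : 0 ≤ R := by rw [hR, hR₁]; positivity
  have hR₁0 : 0 < R₁ := Real.sqrt_pos.2 (by positivity)
  have hR₁R : R₁ < R := by rw [hR]; linarith
  -- the directions and the polydisc
  set vdir : Fin N → (Fin (k + 2) → Fin d → ℂ) := fun p => frameDir ê p with hvdir
  have hmem : ∀ w : Fin N → ℂ, (∀ p, ‖w p‖ ≤ R) → cfgPt x + ∑ p, w p • vdir p ∈ ball (cfgPt x) ρ := by
    intro w hw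
    rw [mem_ball, dist_eq_norm, add_sub_cancel_left]
    calc ‖∑ p, w p • vdir p‖ ≤ ∑ p, ‖w p • vdir p‖ := norm_sum_le _ _
      _ ≤ ∑ _p : Fin N, R := Finset.sum_le_sum fun p _ => by
          rw [norm_smul]
          exact (mul_le_mul (hw p) (norm_frameDir_le ê hê1 p) (norm_nonneg _) hR0).trans (le_of_eq (mul_one _))
      _ = N * R := by simp
      _ < ρ₂ := by rw [hN, hR, hR₁]; push_cast; exact hfit
      _ < ρ := by have := le_trans (by positivity) hr₀eq; linarith
  -- the weighted mean value property
  have hbc : Continuous (radialKernel M r₁) := continuous_radialKernel M r₁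
  have hbR : ∀ t, R₁ ≤ t → radialKernel M r₁ t = 0 := fun t ht => radialKernel_eq_zero M hr₁ ht
  have hmv := Literature.Analysis.Complex.integral_pi_radial_smul_eq_smul hbc hR₁0 hR₁R hbR hSd N (cfgPt x) vdir hmem
  rw [integral_radialKernel_norm M hr₁] at hmv
  have hπN : (0 : ℝ) < π ^ N := by positivity
  have hSx : ‖S (cfgPt x)‖ = (π ^ N)⁻¹ * ‖∫ w : Fin N → ℂ, (∏ p, radialKernel M r₁ ‖w p‖) • S (cfgPt x + ∑ p, w p • vdir p)‖ := by
    rw [hmv, norm_smul, Real.norm_eq_abs, abs_of_pos hπN, ← mul_assoc, inv_mul_cancel₀ hπN.ne', one_mul]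
  -- the integral as an iterated integral
  set G : (Fin N → ℂ) → ℂ := fun w => (∏ p, radialKernel M r₁ ‖w p‖) • S (cfgPt x + ∑ p, w p • vdir p) with hG
  have hGint : Integrable G :=
    (Literature.Analysis.Complex.continuous_prod_radial_smul hbc hR₁R hbR hSd.continuousOn (cfgPt x) vdir hmem).integrable_of_hasCompactSupport
      (Literature.Analysis.Complex.hasCompactSupport_prod_radial_smul hR₁0.le hbR S (cfgPt x) vdir)
  have hΦ := measurePreserving_reImEquiv N
  have hGint' : Integrable (fun p : (Fin N → ℝ) × (Fin N → ℝ) => G ((reImEquiv N).symm p))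
      ((volume : Measure (Fin N → ℝ)).prod volume) :=
    ((hΦ.symm _).integrable_comp_emb (MeasurableEquiv.measurableEmbedding _)).2 hGint
  have hiter : ∫ w, G w = ∫ v : Fin N → ℝ, ∫ u : Fin N → ℝ, G ((reImEquiv N).symm (u, v)) := by
    rw [← (hΦ.symm _).integral_comp', integral_prod_symm _ hGint']
  -- the tube points `ζ_v`
  set ζv : (Fin N → ℝ) → (Fin (k + 2) → Fin d → ℂ) := fun v =>
    cfgPt x + (I : ℂ) • cfgPt (fun j => frameMap ê hli (ucfg v j)) with hζv
  have hζv_mem : ∀ v : Fin N → ℝ, ‖v‖ ≤ R₁ → ζv v ∈ ball (cfgPt x) ρ₂ := by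
    intro v hv
    rw [mem_ball, dist_eq_norm, hζv]
    simp only [add_sub_cancel_left, norm_smul, Complex.norm_I, one_mul]
    calc ‖cfgPt fun j => frameMap ê hli (ucfg v j)‖ ≤ ‖fun j => frameMap ê hli (ucfg v j)‖ := norm_cfgPt_le _
      _ ≤ ‖(frameMap ê hli : EuclideanSpace ℝ (Fin d) →L[ℝ] EuclideanSpace ℝ (Fin d))‖ * Real.sqrt d * R₁ := by
          refine (pi_norm_le_iff_of_nonneg (by positivity)).2 fun j => ?_
          calc ‖frameMap ê hli (ucfg v j)‖ ≤ ‖(frameMap ê hli : EuclideanSpace ℝ (Fin d) →L[ℝ] EuclideanSpace ℝ (Fin d))‖ * ‖ucfg v j‖ :=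
                (frameMap ê hli : EuclideanSpace ℝ (Fin d) →L[ℝ] EuclideanSpace ℝ (Fin d)).le_opNorm _
            _ ≤ ‖(frameMap ê hli : EuclideanSpace ℝ (Fin d) →L[ℝ] EuclideanSpace ℝ (Fin d))‖ * (Real.sqrt d * R₁) :=
                mul_le_mul_of_nonneg_left ((norm_ucfg_le v j).trans (mul_le_mul_of_nonneg_left hv (Real.sqrt_nonneg _))) (norm_nonneg _)
            _ = _ := by ring
      _ < ρ₂ := by rw [hR₁]; exact hfit2
  -- the inner integrals are the values `Θ_v(ζ_v)`
  have hinner : ∀ v : Fin N → ℝ, ∫ u : Fin N → ℝ, G ((reImEquiv N).symm (u, v)) = mvTheta ê hli M hr₁ S (vblocks v) (ζv v) := by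
    intro v
    have hGuv : ∀ u, G ((reImEquiv N).symm (u, v)) =
        (fun c : Fin (k + 2) → EuclideanSpace ℝ (Fin d) => S (ζv v + frameShift ê hli c) * prodKer M hr₁ (vblocks v) c) (ucfg u) := by
      intro u
      rw [reImEquiv_symm_apply]
      simp only [hG, hvdir]
      rw [sum_smul_frameDir_eq ê hli, Complex.real_smul, prod_radialKernel_eq_prodKer M hr₁ u v, mul_comm]
      congr 2
      simp only [hζv, frameShift]
      abel
    simp_rw [hGuv]
    rw [integral_comp_ucfg (fun c : Fin (k + 2) → EuclideanSpace ℝ (Fin d) => S (ζv v + frameShift ê hli c) * prodKer M hr₁ (vblocks v) c)]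
    rfl
  -- bound for the inner integrals
  have hinner_bound : ∀ v : Fin N → ℝ, ‖∫ u : Fin N → ℝ, G ((reImEquiv N).symm (u, v))‖ ≤
      (closedBall (0 : Fin N → ℝ) R₁).indicator (fun _ => GB) v := by
    intro v
    by_cases hvmem : v ∈ closedBall (0 : Fin N → ℝ) R₁
    · rw [indicator_of_mem hvmem, hinner v]
      have hv' : ‖v‖ ≤ R₁ := mem_closedBall_zero_iff.1 hvmem
      have hζ := hζv_mem v hv'
      rw [mvTheta_eqOn_of_realValues 𝔖 ê hli hr₁ hSd hSB hSrep hρ₂ hr₀eq hρρ Γ hΓd hΓreal (vblocks v) hζ]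
      exact hΓB _ _ hζ
    · rw [indicator_of_notMem hvmem]
      have h0 : ∀ u, G ((reImEquiv N).symm (u, v)) = 0 := by
        intro u
        rw [mem_closedBall_zero_iff, pi_norm_le_iff_of_nonneg hR₁0.le] at hvmem
        push Not at hvmem
        obtain ⟨i, hi⟩ := hvmem
        simp only [hG]
        rw [Literature.Analysis.Complex.prod_radial_eq_zero hbR (i := i) ?_, zero_smul]
        rw [reImEquiv_symm_apply]
        exact hi.le.trans (by simpa using abs_im_le_norm (⟨u i, v i⟩ : ℂ))
      simp [h0]
  -- integrability of the dominating indicator and the volume of the cube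
  have hind : Integrable ((closedBall (0 : Fin N → ℝ) R₁).indicator (fun _ => GB)) (volume : Measure (Fin N → ℝ)) := by
    refine (integrable_indicator_iff measurableSet_closedBall).2 ?_
    exact integrableOn_const (isCompact_closedBall _ _).measure_lt_top.ne
  have hvol : (volume : Measure (Fin N → ℝ)).real (closedBall (0 : Fin N → ℝ) R₁) = R ^ N := by
    rw [measureReal_def, Real.volume_pi_closedBall _ hR₁0.le, Fintype.card_fin, ENNReal.toReal_ofReal (by positivity), hR]
  -- assembling
  calc ‖S (cfgPt x)‖ = (π ^ N)⁻¹ * ‖∫ w, G w‖ := hSx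
    _ = (π ^ N)⁻¹ * ‖∫ v : Fin N → ℝ, ∫ u : Fin N → ℝ, G ((reImEquiv N).symm (u, v))‖ := by rw [hiter]
    _ ≤ (π ^ N)⁻¹ * ∫ v : Fin N → ℝ, ‖∫ u : Fin N → ℝ, G ((reImEquiv N).symm (u, v))‖ :=
        mul_le_mul_of_nonneg_left (norm_integral_le_integral_norm _) (by positivity)
    _ ≤ (π ^ N)⁻¹ * ∫ v : Fin N → ℝ, (closedBall (0 : Fin N → ℝ) R₁).indicator (fun _ => GB) v := by
        refine mul_le_mul_of_nonneg_left ?_ (by positivity)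
        exact integral_mono_of_nonneg (ae_of_all _ fun v => norm_nonneg _) hind (ae_of_all _ hinner_bound)
    _ = (π ^ N)⁻¹ * (R ^ N * GB) := by
        rw [integral_indicator_const _ measurableSet_closedBall, hvol, smul_eq_mul]
    _ = _ := by rw [hR, hR₁]; ring

end Bound

end Literature.MathematicalPhysics.QuantumFieldTheory
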